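import Summits.QuantumFields.YangMills.Theorems.BalabanUVNodesN15KingModelComplexLinkOperator
import HarnessLib
/-!
# BalabanUVNodes ∕ N15 — THE KING-MODEL RUNG (PART Ϛ-b): THE NEUMANN ∕ RANDOM-WALK SERIES ON THE COMPLEX WINDOW — `M_{U,V}` IS INVERTIBLE FOR ALL TWO-SIDED LINK FIELDS WITH
# `‖U(b)‖, ‖V(b)‖ ≤ 1+ε`, `2(d+1)cε < m²`, AND ITS INVERSE IS DOMINATED BLOCKWISE BY KING's `A = 0` KERNEL AT THE SHIFTED PARAMETERS `((1+ε)c, m² − 2(d+1)cε)`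
# (Track A, DAG node N15 = NE2; FAN-OUT v1.1 §N15 s3 «KING-MODEL RUNG … + what the curved case adds»; count-neutral)
HONEST FRAMING.  Count-neutral (cell `pub-ymgap`, seat `pub-ymgap-dag-n15-e` g43; `--supports stmt-QuantumFields-27247 --as helper` = K3ᴬ, KEY MAP v3).  One finite torus at fixed
spacing; King's `A = 0` model, FINE covariance layer only; nothing of Bałaban's (3.42) ∕ Thm 3.4 for `G(U)` asserted; nothing continuum ∕ ℝ⁴ ∕ OS ∕ Clay; NOT a node discharge.
THE STATEMENT DECIDED IN THE MODEL.  [Balaban1985BackgroundPropagators] Thm 3.4 p.400: the propagators «extend to configurations U′U … as analytic functions of A. The extended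
operators satisfy all the inequalities of Theorems 3.1–3.3 correspondingly.», proved there (p.399 l.25–33, p.398 l.26–27) «by constructing generalized random walk expansions».
Here, for King's covariant fine operator at a TWO-SIDED complex link field (PART Ϛ-a `cxLapF K c m² U V = D₀·1 − T_{U,V}`, `D₀ = m² + 2(d+1)c`), on the polydisc
`‖U(b)‖_{op} ≤ 1+ε`, `‖V(b)‖_{op} ≤ 1+ε` (all bonds `b`) with `2(d+1)c·ε < m²` (`c ≥ 0`, `m² > 0`, `ε ≥ 0`; fibre `𝕜ⁿ`, `𝕜 = ℝ` or `ℂ`):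
* §1–§2 the SHIFTED PARAMETERS `c′ = (1+ε)c`, `m′² = m² − 2(d+1)cε > 0` have the SAME `D₀` (`shifted_D0`) and King's hopping matrix scales, `T_{c′} = (1+ε)T_c` (`kingHop_mul`); ★★ `l2_opNorm_blk_cxHop_le`:
  `‖(T_{U,V})_{xy}‖_{op} ≤ T_{c′}(x,y)`; ★★ `l2_opNorm_blk_cxHop_pow_le`: `‖(T_{U,V}^k)_{xy}‖_{op} ≤ (T_{c′}^k)(x,y)` (Ͱ-l `l2_opNorm_blk_pow_le`); ★ `l2_opNorm_blk_smul_cxHop_pow_le`: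
  `‖((D₀⁻¹T_{U,V})^N)_{xy}‖_{op} ≤ θ′^N`, `θ′ = 2(d+1)c′∕D₀ < 1` (`thetaShift_lt_one` ⟺ the window inequality);
* §3 ★★★ **`cxLapF_mulVec_eq_zero`** ∕ **`isUnit_cxLapF`**: `M_{U,V}` IS INVERTIBLE on the window (a kernel vector is fixed by every `(D₀⁻¹T_{U,V})^N`, whose entries are `≤ θ′^N → 0`;
  NO Hermitian ∕ positivity structure is available off the adjoint slice — the two-sided telescoping of Ϛ-a replaces it); `cxLapF_mul_inv`∕`cxLapF_inv_mul`, `det_cxLapF_ne_zero`,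
  ★ `partialSum_eq_cxLapF_inv_sub` (`Σ_{k<N}D₀^{−(k+1)}T^k = G − G(D₀⁻¹T)^N`, `G = M⁻¹`);
* §4 ★★★ **`hasSum_blk_cxLapF_inv`** — THE RANDOM WALK REPRESENTATION ON THE COMPLEX WINDOW, BLOCKWISE IN OPERATOR NORM: `(G_{U,V})_{xy} = Σ_{k≥0}D₀^{−(k+1)}(T_{U,V}^k)_{xy}` (absolutely
  convergent in `Matrix n n 𝕜`); ★★★ **`l2_opNorm_blk_cxLapF_inv_le`**: `‖(G_{U,V})_{xy}‖_{op} ≤ (lapF K ((1+ε)c) (m²−2(d+1)cε))⁻¹(x,y)` — KING's `A = 0` COVARIANCE AT THE SHIFTED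
  PARAMETERS MAJORISES THE ANALYTIC EXTENSION (Ͱ-k `hasSum_kingHop_randomWalk` at `(c′,m′²)`), ★★ `norm_cxLapF_inv_entry_le` (entrywise);
* §5 ★★ `l2_opNorm_blk_inv_le_of_window` — CONSISTENCY ON THE UNITARY SLICE: at `ε = 0`, `V = Uᴴ`, `U` unitary, the bound is Ͱ-b's `‖(G_U)_{xy}‖ ≤ (lapF K c m²)⁻¹(x,y)` verbatim.
So print's «the extended operators satisfy all the inequalities … correspondingly» holds in the model with the EXPLICIT price of complexification: the mass `m²` is replaced by
`m² − 2(d+1)cε` and the hopping weight `c` by `(1+ε)c` (PART Ϛ-c reads off decay ∕ diagonal ∕ row-sum bounds; PART Ϛ-d shows the window is SHARP).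
PRIOR TREE ART (by name): Ϛ-a (`cxHop`, `cxLapF`, `blk_cxHop`, `cxLapF_adjoint`, `partialSum_mul_cxLapF`, `cxLapF_mul_partialSum`, `blk_add'`∕`blk_smul'`∕`blk_sum'`), Ͱ-g (`blk_sub'`, `blk_mul'`),
Ͱ-k (`kingHop`, `kingHop_pow_nonneg`, `sum_smul_kingHop_pow_row`, `theta_lt_one`, `hasSum_kingHop_randomWalk`), Ͱ-l (`l2_opNorm_blk_pow_le`, `norm_entry_le_l2_opNorm_blk`,
`l2_opNorm_of_mem_unitaryGroup_le`), Ͱ-b (`l2_opNorm_blk_inv_le`, the `ε = 0` statement), Mathlib (`Matrix.mulVec_injective_iff_isUnit`, `tendsto_pow_atTop_nhds_zero_of_lt_one`,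
`ge_of_tendsto'`, `Summable.of_norm_bounded`, `norm_tsum_le_tsum_norm`, `hasSum_le`, `FiniteDimensional.complete`, `Matrix.Norms.L2Operator`).  Dedup (rg at filing): basename 0 files;
needles `isUnit_cxLapF|hasSum_blk_cxLapF_inv|l2_opNorm_blk_cxLapF_inv_le|kingHop_mul|thetaShift` 0 tree files.  Locators: [Balaban1985BackgroundPropagators] Thm 3.4 p.400, §3.B p.399
l.25–40, p.398 l.26–27, (3.23) p.394, (3.42) p.397; [King1986] (4.4) p.670; [DodziukMathai2006] Thm 1.5 §1 (the unitary case).  0 `sorry`, 0 `def`.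
-/

noncomputable section
open scoped BigOperators ComplexConjugate ComplexOrder Topology Matrix.Norms.L2Operator
open Finset Matrix WithLp Filter

namespace Summit.QuantumFields.YangMills.BalabanUVNodes.N15KingModelRung.Covariant

open Literature.MathematicalPhysics.QuantumFieldTheory.LatticeDiamagneticInequality (Hopping blk)
open Literature.MathematicalPhysics.QuantumFieldTheory.Balaban1983to89.B5Prop11Plancherel (Tor unitVec)
open Literature.MathematicalPhysics.QuantumFieldTheory.King1986.Torus (lapF)

variable {d : ℕ} (K : Fin (d + 1) → ℕ) [hK : ∀ μ, NeZero (K μ)]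
variable {𝕜 : Type*} [RCLike 𝕜] {n : Type*} [Fintype n] [DecidableEq n] {c m2 ε : ℝ}

/-! ## §1 The shifted parameters `c′ = (1+ε)c`, `m′² = m² − 2(d+1)cε` -/

omit hK in
/-- KING's HOPPING MATRIX IS LINEAR IN THE WEIGHT: `T_{ac} = a·T_c`. [cite: King1986, (4.4) p.670] -/
theorem kingHop_mul (a c : ℝ) : kingHop K (a * c) = a • kingHop K c := by
  ext x y
  simp only [kingHop, Matrix.smul_apply, smul_eq_mul, mul_assoc]

/-- THE SHIFTED PARAMETERS HAVE THE SAME SITE WEIGHT: `m′² + 2(d+1)c′ = m² + 2(d+1)c = D₀` for `c′ = (1+ε)c`, `m′² = m² − 2(d+1)cε`. [folklore] -/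
theorem shifted_D0 (c m2 ε : ℝ) :
    (m2 - 2 * ((d : ℝ) + 1) * c * ε) + 2 * ((d : ℝ) + 1) * ((1 + ε) * c) = m2 + 2 * ((d : ℝ) + 1) * c := by ring

/-- THE WINDOW INEQUALITY `2(d+1)cε < m²` is the positivity of the shifted mass `m′² = m² − 2(d+1)cε`. [cite: Balaban1985BackgroundPropagators, Thm 3.4 p.400] -/
theorem shifted_mass_pos (hwin : 2 * ((d : ℝ) + 1) * c * ε < m2) : 0 < m2 - 2 * ((d : ℝ) + 1) * c * ε := by linarith

/-- The shifted weight is non-negative. [folklore] -/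
theorem shifted_weight_nonneg (hc : 0 ≤ c) (hε : 0 ≤ ε) : 0 ≤ (1 + ε) * c := by positivity

/-- ★ THE CONTRACTION RATIO OF THE COMPLEX WINDOW: `θ′ = 2(d+1)(1+ε)c∕D₀ < 1` — equivalent to the window inequality (Ͱ-k `theta_lt_one` at the shifted parameters).
[cite: Balaban1985BackgroundPropagators, p.398 l.26–27, Thm 3.4 p.400] -/
theorem thetaShift_lt_one (hc : 0 ≤ c) (hε : 0 ≤ ε) (hwin : 2 * ((d : ℝ) + 1) * c * ε < m2) :
    2 * ((d : ℝ) + 1) * ((1 + ε) * c) / (m2 + 2 * ((d : ℝ) + 1) * c) < 1 := by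
  have h := theta_lt_one (d := d) (shifted_weight_nonneg hc hε) (shifted_mass_pos hwin)
  rwa [shifted_D0] at h

/-- `θ′ ≥ 0`. [folklore] -/
theorem thetaShift_nonneg (hc : 0 ≤ c) (hε : 0 ≤ ε) (hm : 0 < m2) :
    0 ≤ 2 * ((d : ℝ) + 1) * ((1 + ε) * c) / (m2 + 2 * ((d : ℝ) + 1) * c) := by positivity

/-! ## §2 Domination of the two-sided hopping matrix and of its powers -/

/-- ★★ **THE TWO-SIDED HOPPING BLOCKS ARE DOMINATED BY KING's HOPPING MATRIX AT THE SHIFTED WEIGHT**: `‖(T_{U,V})_{xy}‖_{op} ≤ T_{(1+ε)c}(x,y)` whenever `‖U(b)‖, ‖V(b)‖ ≤ 1+ε`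
(each block is `c` times a transporter of norm `≤ 1+ε`, or zero). [cite: Balaban1985BackgroundPropagators, (3.23) p.394, p.398 l.26–27; King1986, (4.4) p.670] -/
theorem l2_opNorm_blk_cxHop_le (hc : 0 ≤ c) {U V : Tor K × Fin (d + 1) → Matrix n n 𝕜}
    (hU : ∀ b, ‖U b‖ ≤ 1 + ε) (hV : ∀ b, ‖V b‖ ≤ 1 + ε) (x y : Tor K) :
    ‖blk (cxHop K c U V) x y‖ ≤ kingHop K ((1 + ε) * c) x y := by
  rw [blk_cxHop, kingHop, norm_smul, RCLike.norm_ofReal, abs_of_nonneg hc]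
  have h1 : ∀ μ : Fin (d + 1), ‖(if y = x + unitVec K μ then U (x, μ) else 0) + (if y = x - unitVec K μ then V (x - unitVec K μ, μ) else 0)‖
      ≤ (1 + ε) * ((if y = x + unitVec K μ then (1 : ℝ) else 0) + (if y = x - unitVec K μ then 1 else 0)) := fun μ => by
    refine (norm_add_le _ _).trans ?_
    rw [mul_add]
    refine add_le_add ?_ ?_
    · split_ifs
      · rw [mul_one]; exact hU _
      · rw [norm_zero, mul_zero]
    · split_ifs
      · rw [mul_one]; exact hV _
      · rw [norm_zero, mul_zero]
  calc c * ‖∑ μ, ((if y = x + unitVec K μ then U (x, μ) else 0) + (if y = x - unitVec K μ then V (x - unitVec K μ, μ) else 0))‖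
      ≤ c * ∑ μ, (1 + ε) * ((if y = x + unitVec K μ then (1 : ℝ) else 0) + (if y = x - unitVec K μ then 1 else 0)) :=
        mul_le_mul_of_nonneg_left ((norm_sum_le _ _).trans (Finset.sum_le_sum fun μ _ => h1 μ)) hc
    _ = (1 + ε) * c * ∑ μ, ((if y = x + unitVec K μ then (1 : ℝ) else 0) + (if y = x - unitVec K μ then 1 else 0)) := by
        rw [← Finset.mul_sum]; ring

/-- ★★ **WALKS OF CONTRACTIONS-UP-TO-`ε`**: `‖(T_{U,V}^k)_{xy}‖_{op} ≤ (T_{(1+ε)c}^k)(x,y)` — an ordered product of `k` transporters of norm `≤ 1+ε` along a `k`-step walk has norm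
`≤ (1+ε)^k`, which the shifted weight absorbs. [cite: Balaban1985BackgroundPropagators, p.398 l.26–27] -/
theorem l2_opNorm_blk_cxHop_pow_le (hc : 0 ≤ c) {U V : Tor K × Fin (d + 1) → Matrix n n 𝕜}
    (hU : ∀ b, ‖U b‖ ≤ 1 + ε) (hV : ∀ b, ‖V b‖ ≤ 1 + ε) (k : ℕ) (x y : Tor K) :
    ‖blk (cxHop K c U V ^ k) x y‖ ≤ (kingHop K ((1 + ε) * c) ^ k) x y :=
  l2_opNorm_blk_pow_le K (l2_opNorm_blk_cxHop_le K hc hU hV) k x y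

/-- Entrywise: `|(T_{U,V}^k)((x,i),(y,j))| ≤ (T_{(1+ε)c}^k)(x,y)`. [cite: Balaban1985BackgroundPropagators, p.398 l.26–27] -/
theorem norm_cxHop_pow_entry_le (hc : 0 ≤ c) {U V : Tor K × Fin (d + 1) → Matrix n n 𝕜}
    (hU : ∀ b, ‖U b‖ ≤ 1 + ε) (hV : ∀ b, ‖V b‖ ≤ 1 + ε) (k : ℕ) (x y : Tor K) (i j : n) :
    ‖(cxHop K c U V ^ k) (x, i) (y, j)‖ ≤ (kingHop K ((1 + ε) * c) ^ k) x y :=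
  (norm_entry_le_l2_opNorm_blk K _ x y i j).trans (l2_opNorm_blk_cxHop_pow_le K hc hU hV k x y)

/-- ★ THE GEOMETRIC REMAINDER: `‖((D₀⁻¹T_{U,V})^N)_{xy}‖_{op} ≤ θ′^N`, `θ′ = 2(d+1)(1+ε)c∕D₀` (row sums of the shifted free walk, Ͱ-k `sum_smul_kingHop_pow_row`).
[cite: Balaban1985BackgroundPropagators, p.398 l.26–27] -/
theorem l2_opNorm_blk_smul_cxHop_pow_le (hc : 0 ≤ c) (hm : 0 < m2) (hε : 0 ≤ ε) {U V : Tor K × Fin (d + 1) → Matrix n n 𝕜}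
    (hU : ∀ b, ‖U b‖ ≤ 1 + ε) (hV : ∀ b, ‖V b‖ ≤ 1 + ε) (N : ℕ) (x y : Tor K) :
    ‖blk (((((m2 + 2 * ((d : ℝ) + 1) * c : ℝ) : 𝕜)⁻¹) • cxHop K c U V) ^ N) x y‖
      ≤ (2 * ((d : ℝ) + 1) * ((1 + ε) * c) / (m2 + 2 * ((d : ℝ) + 1) * c)) ^ N := by
  have hD0 : 0 < m2 + 2 * ((d : ℝ) + 1) * c := by positivity
  rw [smul_pow, blk_smul', norm_smul, norm_pow, norm_inv, RCLike.norm_ofReal, abs_of_pos hD0]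
  calc (m2 + 2 * ((d : ℝ) + 1) * c)⁻¹ ^ N * ‖blk (cxHop K c U V ^ N) x y‖
      ≤ (m2 + 2 * ((d : ℝ) + 1) * c)⁻¹ ^ N * (kingHop K ((1 + ε) * c) ^ N) x y :=
        mul_le_mul_of_nonneg_left (l2_opNorm_blk_cxHop_pow_le K hc hU hV N x y) (pow_nonneg (inv_nonneg.2 hD0.le) _)
    _ = (((m2 + 2 * ((d : ℝ) + 1) * c)⁻¹ • kingHop K ((1 + ε) * c)) ^ N) x y := by rw [smul_pow, Matrix.smul_apply, smul_eq_mul]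
    _ ≤ ∑ w, (((m2 + 2 * ((d : ℝ) + 1) * c)⁻¹ • kingHop K ((1 + ε) * c)) ^ N) x w :=
        Finset.single_le_sum (fun w _ => by
          rw [smul_pow, Matrix.smul_apply, smul_eq_mul]
          exact mul_nonneg (pow_nonneg (inv_nonneg.2 hD0.le) _) (kingHop_pow_nonneg K (shifted_weight_nonneg hc hε) N x w)) (Finset.mem_univ y)
    _ = (2 * ((d : ℝ) + 1) * ((1 + ε) * c) / (m2 + 2 * ((d : ℝ) + 1) * c)) ^ N := by
        have h := sum_smul_kingHop_pow_row K ((1 + ε) * c) (m2 - 2 * ((d : ℝ) + 1) * c * ε) N x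
        rwa [shifted_D0] at h

/-- Entrywise geometric remainder: `|((D₀⁻¹T_{U,V})^N)(p,q)| ≤ θ′^N`. [cite: Balaban1985BackgroundPropagators, p.398 l.26–27] -/
theorem norm_smul_cxHop_pow_entry_le (hc : 0 ≤ c) (hm : 0 < m2) (hε : 0 ≤ ε) {U V : Tor K × Fin (d + 1) → Matrix n n 𝕜}
    (hU : ∀ b, ‖U b‖ ≤ 1 + ε) (hV : ∀ b, ‖V b‖ ≤ 1 + ε) (N : ℕ) (p q : Tor K × n) :
    ‖(((((m2 + 2 * ((d : ℝ) + 1) * c : ℝ) : 𝕜)⁻¹) • cxHop K c U V) ^ N) p q‖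
      ≤ (2 * ((d : ℝ) + 1) * ((1 + ε) * c) / (m2 + 2 * ((d : ℝ) + 1) * c)) ^ N := by
  obtain ⟨x, i⟩ := p
  obtain ⟨y, j⟩ := q
  exact (norm_entry_le_l2_opNorm_blk K _ x y i j).trans (l2_opNorm_blk_smul_cxHop_pow_le K hc hm hε hU hV N x y)

/-! ## §3 Invertibility on the complex window -/

/-- ★★★ **THE KERNEL IS TRIVIAL ON THE WINDOW**: if `‖U(b)‖, ‖V(b)‖ ≤ 1+ε` with `2(d+1)cε < m²` then `M_{U,V}v = 0 ⟹ v = 0` — from `S_N·M_{U,V} = 1 − (D₀⁻¹T_{U,V})^N` a kernel vector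
satisfies `v = (D₀⁻¹T_{U,V})^N v` for every `N`, and the entries of `(D₀⁻¹T_{U,V})^N` are `≤ θ′^N → 0`. [cite: Balaban1985BackgroundPropagators, Thm 3.4 p.400, p.398 l.26–27] -/
theorem cxLapF_mulVec_eq_zero (hc : 0 ≤ c) (hm : 0 < m2) (hε : 0 ≤ ε) (hwin : 2 * ((d : ℝ) + 1) * c * ε < m2)
    {U V : Tor K × Fin (d + 1) → Matrix n n 𝕜} (hU : ∀ b, ‖U b‖ ≤ 1 + ε) (hV : ∀ b, ‖V b‖ ≤ 1 + ε)
    {v : Tor K × n → 𝕜} (hv : cxLapF K c m2 U V *ᵥ v = 0) : v = 0 := by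
  set R : Matrix (Tor K × n) (Tor K × n) 𝕜 := ((((m2 + 2 * ((d : ℝ) + 1) * c : ℝ) : 𝕜)⁻¹) • cxHop K c U V) with hR
  set θ : ℝ := 2 * ((d : ℝ) + 1) * ((1 + ε) * c) / (m2 + 2 * ((d : ℝ) + 1) * c) with hθdef
  have hθ1 : θ < 1 := thetaShift_lt_one hc hε hwin
  have hθ0 : 0 ≤ θ := thetaShift_nonneg hc hε hm
  -- the kernel vector is fixed by every power of `R`
  have hfix : ∀ N : ℕ, (R ^ N) *ᵥ v = v := fun N => by
    have h := partialSum_mul_cxLapF K (𝕜 := 𝕜) (n := n) hc hm U V N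
    have h2 : ((∑ k ∈ Finset.range N, ((((m2 + 2 * ((d : ℝ) + 1) * c : ℝ) : 𝕜)⁻¹) ^ (k + 1)) • cxHop K c U V ^ k) * cxLapF K c m2 U V) *ᵥ v
        = (1 - R ^ N) *ᵥ v := by rw [h]
    rw [← Matrix.mulVec_mulVec, hv, Matrix.mulVec_zero, Matrix.sub_mulVec, Matrix.one_mulVec] at h2
    exact (sub_eq_zero.mp h2.symm).symm
  -- hence every component is `≤ θ^N · Σ_q |v q|`
  have hbound : ∀ (N : ℕ) (p : Tor K × n), ‖v p‖ ≤ θ ^ N * ∑ q, ‖v q‖ := fun N p => by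
    have hp : v p = ∑ q, (R ^ N) p q * v q := by
      conv_lhs => rw [← hfix N]
      simp only [Matrix.mulVec, dotProduct]
    rw [hp, Finset.mul_sum]
    refine (norm_sum_le _ _).trans (Finset.sum_le_sum fun q _ => ?_)
    rw [norm_mul]
    exact mul_le_mul_of_nonneg_right (norm_smul_cxHop_pow_entry_le K hc hm hε hU hV N p q) (norm_nonneg _)
  -- let `N → ∞`
  have hlim : Tendsto (fun N : ℕ => θ ^ N * ∑ q, ‖v q‖) atTop (𝓝 0) := by
    have h := (tendsto_pow_atTop_nhds_zero_of_lt_one hθ0 hθ1).mul_const (∑ q, ‖v q‖)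
    rwa [zero_mul] at h
  funext p
  have hle : ‖v p‖ ≤ 0 := ge_of_tendsto' hlim (fun N => hbound N p)
  exact norm_le_zero_iff.mp hle

/-- `M_{U,V}` acts injectively on the window. [cite: Balaban1985BackgroundPropagators, Thm 3.4 p.400] -/
theorem cxLapF_mulVec_injective (hc : 0 ≤ c) (hm : 0 < m2) (hε : 0 ≤ ε) (hwin : 2 * ((d : ℝ) + 1) * c * ε < m2)
    {U V : Tor K × Fin (d + 1) → Matrix n n 𝕜} (hU : ∀ b, ‖U b‖ ≤ 1 + ε) (hV : ∀ b, ‖V b‖ ≤ 1 + ε) :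
    Function.Injective (cxLapF K c m2 U V).mulVec := fun v w h => by
  rw [← sub_eq_zero]
  refine cxLapF_mulVec_eq_zero K hc hm hε hwin hU hV ?_
  rw [Matrix.mulVec_sub, h, sub_self]

/-- ★★★ **`M_{U,V}` IS INVERTIBLE ON THE COMPLEX WINDOW** `‖U(b)‖, ‖V(b)‖ ≤ 1+ε`, `2(d+1)cε < m²` — the model form of the EXISTENCE half of [B9] Thm 3.4 («extend to
configurations U′U»); no unitarity, no Hermitian structure. [cite: Balaban1985BackgroundPropagators, Thm 3.4 p.400] -/
theorem isUnit_cxLapF (hc : 0 ≤ c) (hm : 0 < m2) (hε : 0 ≤ ε) (hwin : 2 * ((d : ℝ) + 1) * c * ε < m2)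
    {U V : Tor K × Fin (d + 1) → Matrix n n 𝕜} (hU : ∀ b, ‖U b‖ ≤ 1 + ε) (hV : ∀ b, ‖V b‖ ≤ 1 + ε) :
    IsUnit (cxLapF K c m2 U V) :=
  Matrix.mulVec_injective_iff_isUnit.mp (cxLapF_mulVec_injective K hc hm hε hwin hU hV)

/-- `det M_{U,V}` is a unit on the window. [cite: Balaban1985BackgroundPropagators, Thm 3.4 p.400] -/
theorem isUnit_det_cxLapF (hc : 0 ≤ c) (hm : 0 < m2) (hε : 0 ≤ ε) (hwin : 2 * ((d : ℝ) + 1) * c * ε < m2)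
    {U V : Tor K × Fin (d + 1) → Matrix n n 𝕜} (hU : ∀ b, ‖U b‖ ≤ 1 + ε) (hV : ∀ b, ‖V b‖ ≤ 1 + ε) :
    IsUnit (cxLapF K c m2 U V).det :=
  (Matrix.isUnit_iff_isUnit_det _).mp (isUnit_cxLapF K hc hm hε hwin hU hV)

/-- `det M_{U,V} ≠ 0` on the window (the complex Gaussian normalisation does not vanish). [cite: Balaban1985BackgroundPropagators, Thm 3.4 p.400] -/
theorem det_cxLapF_ne_zero (hc : 0 ≤ c) (hm : 0 < m2) (hε : 0 ≤ ε) (hwin : 2 * ((d : ℝ) + 1) * c * ε < m2)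
    {U V : Tor K × Fin (d + 1) → Matrix n n 𝕜} (hU : ∀ b, ‖U b‖ ≤ 1 + ε) (hV : ∀ b, ‖V b‖ ≤ 1 + ε) :
    (cxLapF K c m2 U V).det ≠ 0 :=
  (isUnit_det_cxLapF K hc hm hε hwin hU hV).ne_zero

/-- `M_{U,V}·G_{U,V} = 1`, `G_{U,V} := M_{U,V}⁻¹`. [cite: Balaban1985BackgroundPropagators, Thm 3.4 p.400] -/
theorem cxLapF_mul_inv (hc : 0 ≤ c) (hm : 0 < m2) (hε : 0 ≤ ε) (hwin : 2 * ((d : ℝ) + 1) * c * ε < m2)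
    {U V : Tor K × Fin (d + 1) → Matrix n n 𝕜} (hU : ∀ b, ‖U b‖ ≤ 1 + ε) (hV : ∀ b, ‖V b‖ ≤ 1 + ε) :
    cxLapF K c m2 U V * (cxLapF K c m2 U V)⁻¹ = 1 :=
  Matrix.mul_nonsing_inv _ (isUnit_det_cxLapF K hc hm hε hwin hU hV)

/-- `G_{U,V}·M_{U,V} = 1`. [cite: Balaban1985BackgroundPropagators, Thm 3.4 p.400] -/
theorem cxLapF_inv_mul (hc : 0 ≤ c) (hm : 0 < m2) (hε : 0 ≤ ε) (hwin : 2 * ((d : ℝ) + 1) * c * ε < m2)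
    {U V : Tor K × Fin (d + 1) → Matrix n n 𝕜} (hU : ∀ b, ‖U b‖ ≤ 1 + ε) (hV : ∀ b, ‖V b‖ ≤ 1 + ε) :
    (cxLapF K c m2 U V)⁻¹ * cxLapF K c m2 U V = 1 :=
  Matrix.nonsing_inv_mul _ (isUnit_det_cxLapF K hc hm hε hwin hU hV)

/-- ★ THE PARTIAL SUMS: `Σ_{k<N}D₀^{−(k+1)}T_{U,V}^k = G_{U,V} − G_{U,V}·(D₀⁻¹T_{U,V})^N` on the window. [cite: Balaban1985BackgroundPropagators, p.398 l.26–27] -/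
theorem partialSum_eq_cxLapF_inv_sub (hc : 0 ≤ c) (hm : 0 < m2) (hε : 0 ≤ ε) (hwin : 2 * ((d : ℝ) + 1) * c * ε < m2)
    {U V : Tor K × Fin (d + 1) → Matrix n n 𝕜} (hU : ∀ b, ‖U b‖ ≤ 1 + ε) (hV : ∀ b, ‖V b‖ ≤ 1 + ε) (N : ℕ) :
    ∑ k ∈ Finset.range N, ((((m2 + 2 * ((d : ℝ) + 1) * c : ℝ) : 𝕜)⁻¹) ^ (k + 1)) • cxHop K c U V ^ k
      = (cxLapF K c m2 U V)⁻¹ - (cxLapF K c m2 U V)⁻¹ * ((((m2 + 2 * ((d : ℝ) + 1) * c : ℝ) : 𝕜)⁻¹) • cxHop K c U V) ^ N := by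
  have h := congrArg ((cxLapF K c m2 U V)⁻¹ * ·) (cxLapF_mul_partialSum K hc hm U V N)
  rwa [← Matrix.mul_assoc, cxLapF_inv_mul K hc hm hε hwin hU hV, Matrix.one_mul, Matrix.mul_sub, Matrix.mul_one] at h

/-! ## §4 The random walk representation on the window and the domination at the shifted parameters -/

/-- KING's FREE WALK EXPANSION AT THE SHIFTED PARAMETERS, with `D₀` unshifted: `Σ_kD₀^{−(k+1)}(T_{(1+ε)c}^k)(x,y) = (lapF K ((1+ε)c) (m²−2(d+1)cε))⁻¹(x,y)`.
[cite: King1986, (4.4) p.670; Balaban1985BackgroundPropagators, p.398 l.26–27] -/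
theorem hasSum_kingHop_randomWalk_shifted (hc : 0 ≤ c) (hε : 0 ≤ ε) (hwin : 2 * ((d : ℝ) + 1) * c * ε < m2) (x y : Tor K) :
    HasSum (fun k => (m2 + 2 * ((d : ℝ) + 1) * c)⁻¹ ^ (k + 1) * (kingHop K ((1 + ε) * c) ^ k) x y)
      ((lapF K ((1 + ε) * c) (m2 - 2 * ((d : ℝ) + 1) * c * ε))⁻¹ x y) := by
  have h := hasSum_kingHop_randomWalk K (shifted_weight_nonneg hc hε) (shifted_mass_pos hwin) x y
  rwa [shifted_D0] at h

/-- The terms of the block series are dominated by the shifted free terms. [cite: Balaban1985BackgroundPropagators, p.398 l.26–27] -/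
theorem norm_blk_randomWalk_term_le (hc : 0 ≤ c) (hm : 0 < m2) {U V : Tor K × Fin (d + 1) → Matrix n n 𝕜}
    (hU : ∀ b, ‖U b‖ ≤ 1 + ε) (hV : ∀ b, ‖V b‖ ≤ 1 + ε) (k : ℕ) (x y : Tor K) :
    ‖((((m2 + 2 * ((d : ℝ) + 1) * c : ℝ) : 𝕜)⁻¹) ^ (k + 1)) • blk (cxHop K c U V ^ k) x y‖
      ≤ (m2 + 2 * ((d : ℝ) + 1) * c)⁻¹ ^ (k + 1) * (kingHop K ((1 + ε) * c) ^ k) x y := by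
  have hD0 : 0 < m2 + 2 * ((d : ℝ) + 1) * c := by positivity
  rw [norm_smul, norm_pow, norm_inv, RCLike.norm_ofReal, abs_of_pos hD0]
  exact mul_le_mul_of_nonneg_left (l2_opNorm_blk_cxHop_pow_le K hc hU hV k x y) (pow_nonneg (inv_nonneg.2 hD0.le) _)

/-- ★★★ **THE RANDOM WALK REPRESENTATION ON THE COMPLEX WINDOW (blockwise, operator norm)**: for `‖U(b)‖, ‖V(b)‖ ≤ 1+ε`, `2(d+1)cε < m²`, every `x, y`:
`(G_{U,V})_{xy} = Σ_{k≥0}D₀^{−(k+1)}(T_{U,V}^k)_{xy}` in `Matrix n n 𝕜` — the sum over nearest-neighbour walks `x → y` of `c^{|ω|}∕D₀^{|ω|+1}` times the ordered product of the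
(forward `U`, backward `V`) link variables along the walk; absolutely convergent, dominated termwise by King's `A = 0` expansion at the shifted parameters.
[cite: Balaban1985BackgroundPropagators, p.398 l.26–27, p.399 l.25–33, Thm 3.4 p.400; King1986, (4.4) p.670] -/
theorem hasSum_blk_cxLapF_inv (hc : 0 ≤ c) (hm : 0 < m2) (hε : 0 ≤ ε) (hwin : 2 * ((d : ℝ) + 1) * c * ε < m2)
    {U V : Tor K × Fin (d + 1) → Matrix n n 𝕜} (hU : ∀ b, ‖U b‖ ≤ 1 + ε) (hV : ∀ b, ‖V b‖ ≤ 1 + ε) (x y : Tor K) :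
    HasSum (fun k => ((((m2 + 2 * ((d : ℝ) + 1) * c : ℝ) : 𝕜)⁻¹) ^ (k + 1)) • blk (cxHop K c U V ^ k) x y)
      (blk (cxLapF K c m2 U V)⁻¹ x y) := by
  haveI : CompleteSpace (Matrix n n 𝕜) := FiniteDimensional.complete 𝕜 _
  set R : Matrix (Tor K × n) (Tor K × n) 𝕜 := ((((m2 + 2 * ((d : ℝ) + 1) * c : ℝ) : 𝕜)⁻¹) • cxHop K c U V) with hR
  set θ : ℝ := 2 * ((d : ℝ) + 1) * ((1 + ε) * c) / (m2 + 2 * ((d : ℝ) + 1) * c) with hθdef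
  have hθ1 : θ < 1 := thetaShift_lt_one hc hε hwin
  have hθ0 : 0 ≤ θ := thetaShift_nonneg hc hε hm
  -- absolute convergence by the shifted free majorant
  have hsumm : Summable (fun k => ((((m2 + 2 * ((d : ℝ) + 1) * c : ℝ) : 𝕜)⁻¹) ^ (k + 1)) • blk (cxHop K c U V ^ k) x y) :=
    Summable.of_norm_bounded (hasSum_kingHop_randomWalk_shifted K hc hε hwin x y).summable
      (fun k => norm_blk_randomWalk_term_le K hc hm hU hV k x y)
  -- the partial sums are `G_{xy} − (G R^N)_{xy}`
  have hpart : ∀ N, ∑ k ∈ Finset.range N, ((((m2 + 2 * ((d : ℝ) + 1) * c : ℝ) : 𝕜)⁻¹) ^ (k + 1)) • blk (cxHop K c U V ^ k) x y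
      = blk (cxLapF K c m2 U V)⁻¹ x y - blk ((cxLapF K c m2 U V)⁻¹ * R ^ N) x y := fun N => by
    have h := congrArg (fun A => blk A x y) (partialSum_eq_cxLapF_inv_sub K hc hm hε hwin hU hV N)
    rw [blk_sum', blk_sub'] at h
    simpa only [blk_smul'] using h
  -- the remainder tends to zero
  have hrem : Tendsto (fun N => blk ((cxLapF K c m2 U V)⁻¹ * R ^ N) x y) atTop (𝓝 0) := by
    have hgeo := tendsto_pow_atTop_nhds_zero_of_lt_one hθ0 hθ1
    have hB := hgeo.const_mul (∑ z, ‖blk (cxLapF K c m2 U V)⁻¹ x z‖)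
    rw [mul_zero] at hB
    refine squeeze_zero_norm (fun N => ?_) hB
    rw [blk_mul', Finset.sum_mul]
    refine (norm_sum_le _ _).trans (Finset.sum_le_sum fun z _ => (norm_mul_le _ _).trans ?_)
    exact mul_le_mul_of_nonneg_left (l2_opNorm_blk_smul_cxHop_pow_le K hc hm hε hU hV N z y) (norm_nonneg _)
  have hlim : Tendsto (fun N => ∑ k ∈ Finset.range N, ((((m2 + 2 * ((d : ℝ) + 1) * c : ℝ) : 𝕜)⁻¹) ^ (k + 1)) • blk (cxHop K c U V ^ k) x y)
      atTop (𝓝 (blk (cxLapF K c m2 U V)⁻¹ x y)) := by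
    simp only [hpart]
    have h := hrem.const_sub (blk (cxLapF K c m2 U V)⁻¹ x y)
    rwa [sub_zero] at h
  have huniq := tendsto_nhds_unique hsumm.hasSum.tendsto_sum_nat hlim
  rw [← huniq]
  exact hsumm.hasSum

/-- ★★★ **DOMINATION OF THE ANALYTIC EXTENSION BY KING's `A = 0` COVARIANCE AT THE SHIFTED PARAMETERS**: for `c ≥ 0`, `m² > 0`, `ε ≥ 0` with `2(d+1)cε < m²`, every two-sided
link field with `‖U(b)‖, ‖V(b)‖ ≤ 1+ε`, all sites `x, y`:  `‖(G_{U,V})_{xy}‖_{op} ≤ (lapF K ((1+ε)c) (m² − 2(d+1)cε))⁻¹(x,y)`.  «The extended operators satisfy all the inequalities of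
Theorems 3.1–3.3 correspondingly» — in the model, with the mass lowered by `2(d+1)cε` and the hopping weight raised to `(1+ε)c`.
[cite: Balaban1985BackgroundPropagators, Thm 3.4 p.400, (3.42) p.397; King1986, (4.4) p.670] -/
theorem l2_opNorm_blk_cxLapF_inv_le (hc : 0 ≤ c) (hm : 0 < m2) (hε : 0 ≤ ε) (hwin : 2 * ((d : ℝ) + 1) * c * ε < m2)
    {U V : Tor K × Fin (d + 1) → Matrix n n 𝕜} (hU : ∀ b, ‖U b‖ ≤ 1 + ε) (hV : ∀ b, ‖V b‖ ≤ 1 + ε) (x y : Tor K) :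
    ‖blk (cxLapF K c m2 U V)⁻¹ x y‖ ≤ (lapF K ((1 + ε) * c) (m2 - 2 * ((d : ℝ) + 1) * c * ε))⁻¹ x y := by
  haveI : CompleteSpace (Matrix n n 𝕜) := FiniteDimensional.complete 𝕜 _
  have hW := hasSum_blk_cxLapF_inv K hc hm hε hwin hU hV x y
  have hF := hasSum_kingHop_randomWalk_shifted K hc hε hwin x y
  have hnorm : Summable (fun k => ‖((((m2 + 2 * ((d : ℝ) + 1) * c : ℝ) : 𝕜)⁻¹) ^ (k + 1)) • blk (cxHop K c U V ^ k) x y‖) :=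
    Summable.of_nonneg_of_le (fun k => norm_nonneg _) (fun k => norm_blk_randomWalk_term_le K hc hm hU hV k x y) hF.summable
  rw [← hW.tsum_eq]
  exact (norm_tsum_le_tsum_norm hnorm).trans
    (hasSum_le (fun k => norm_blk_randomWalk_term_le K hc hm hU hV k x y) hnorm.hasSum hF)

/-- ★★ ENTRYWISE DOMINATION: `|G_{U,V}((x,i),(y,j))| ≤ (lapF K ((1+ε)c) (m²−2(d+1)cε))⁻¹(x,y)`. [cite: Balaban1985BackgroundPropagators, Thm 3.4 p.400, (3.42) p.397] -/
theorem norm_cxLapF_inv_entry_le (hc : 0 ≤ c) (hm : 0 < m2) (hε : 0 ≤ ε) (hwin : 2 * ((d : ℝ) + 1) * c * ε < m2)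
    {U V : Tor K × Fin (d + 1) → Matrix n n 𝕜} (hU : ∀ b, ‖U b‖ ≤ 1 + ε) (hV : ∀ b, ‖V b‖ ≤ 1 + ε) (x y : Tor K) (i j : n) :
    ‖(cxLapF K c m2 U V)⁻¹ (x, i) (y, j)‖ ≤ (lapF K ((1 + ε) * c) (m2 - 2 * ((d : ℝ) + 1) * c * ε))⁻¹ x y :=
  (norm_entry_le_l2_opNorm_blk K _ x y i j).trans (l2_opNorm_blk_cxLapF_inv_le K hc hm hε hwin hU hV x y)

/-! ## §5 Consistency on the unitary slice -/

omit hK in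
/-- A unitary link field lies in the window of radius `1 + 0`, together with its adjoint. [folklore] -/
theorem unitary_mem_window {U : Tor K × Fin (d + 1) → Matrix n n 𝕜} (hU : ∀ b, U b ∈ Matrix.unitaryGroup n 𝕜) :
    (∀ b, ‖U b‖ ≤ 1 + 0) ∧ (∀ b, ‖(U b)ᴴ‖ ≤ 1 + 0) := by
  refine ⟨fun b => ?_, fun b => ?_⟩
  · rw [add_zero]; exact l2_opNorm_of_mem_unitaryGroup_le (hU b)
  · rw [add_zero, Matrix.l2_opNorm_conjTranspose]; exact l2_opNorm_of_mem_unitaryGroup_le (hU b)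

/-- ★★ **CONSISTENCY ON THE UNITARY SLICE**: at `ε = 0`, `V = Uᴴ`, `U` unitary, §4 is PART Ͱ-b's `‖(G_U)_{xy}‖_{op} ≤ (lapF K c m²)⁻¹(x,y)` verbatim (Ͱ-b `l2_opNorm_blk_inv_le`,
re-derived through the two-sided series). [cite: Balaban1985BackgroundPropagators, (3.42) p.397, Thm 3.4 p.400; King1986, (4.4) p.670] -/
theorem l2_opNorm_blk_inv_le_of_window (hc : 0 ≤ c) (hm : 0 < m2) {U : Tor K × Fin (d + 1) → Matrix n n 𝕜}
    (hU : ∀ b, U b ∈ Matrix.unitaryGroup n 𝕜) (x y : Tor K) :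
    ‖blk (covLapF K c m2 U)⁻¹ x y‖ ≤ (lapF K c m2)⁻¹ x y := by
  have hwin : 2 * ((d : ℝ) + 1) * c * 0 < m2 := by rw [mul_zero]; exact hm
  have h := l2_opNorm_blk_cxLapF_inv_le K hc hm le_rfl hwin (unitary_mem_window K hU).1 (unitary_mem_window K hU).2 x y
  rwa [cxLapF_adjoint, add_zero, one_mul, mul_zero, sub_zero] at h

end Summit.QuantumFields.YangMills.BalabanUVNodes.N15KingModelRung.Covariant

end
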